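import Summits.AnomalousDissipation.AnomalousDissipation.Theorems.SolenoidalFractalHomogenisationLagrangianStepCellLawVSlowGraphLinearResponse
import HarnessLib

/-!
# K1L `LagrangianRenormalisationStep(Design)` (K1L_D, stmt-AnomalousDissipation-27980; aside 24912), stub `stub_cellLawV0_IS`
# — the ABSTRACT SLOW-GRAPH LEVER, part 9: slow-amplitude tracking by the HOMOGENISED generator built from the LINEAR periodic response
# (helper; `--supports stmt-AnomalousDissipation-27980`; word-independent)

Summits-side helper file of route `SolenoidalFractalHomogenisation` (planner ad-ideate-p5's STUB-PLAN for `stub_cellLawV` §1 (V), tenure D24-1; crux idea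
`chang-slow-graph`), on top of parts 1–8.  THE STATEMENT D1 CAN CONSUME.  `slow_tracking_linear_response` (G8): for the block system `ẋ = A₁₁x + A₁₂z`,
`ż = A₂₁x + A₂₂z` with `P`-periodic continuous coefficients and G1's constants, the slow component started on the empty graph (`z 0 = 0`) tracks
`e^{−tḠ₁}x 0` where `Ḡ₁ = −(1/P)∫₀ᴾ (A₁₁ + A₁₂N)` is built from the periodic solution `N` of the LINEAR equation `Ṅ = A₂₁ + A₂₂N` (part 8,
`linearGraph_periodic_on`; in the cell system: the periodic first-order corrector, so `−mean(A₁₂N)` is the classical homogenised coefficient, exactly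
quadratic in the Bloch momentum), with DECAY-RELATIVE error `η·min(t, 1/r_lo)`, `η = [transients]/P + δ·r(s₀+δr)/γ` (the persistent part is G3/G7's
relatively quadratic defect of the graph against its linear part — `σ = 2`), plus the burst `O((s₀+δr)P)`.  Coercivity of `Ḡ₁` and the a priori bound on
`x` are hypotheses (positivity of the effective tensor = the (W) half; energy inequality), as in G6′; §19 `norm_slow_le_of_dissipative` (amendment 1)
supplies the a priori bound `‖x t‖ ≤ ‖x 0‖` from dissipativity of the full block generator.  No named facts, no new definitions, no sorry.
Infrastructure for route-1's rung leaf F-D1.A0 (frontier FORMAL rung); NOT a proof of the stub, of the crux, of Onsager's conjecture or of anomalous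
dissipation.  Prover seat `ad-k1l-cellLawV-w1` g3, 2026-08-28.
-/

set_option linter.dupNamespace false

noncomputable section

namespace Summit.AnomalousDissipation.AnomalousDissipation.Theorems.SolenoidalFractalHomogenisation.LagrangianStep

namespace SlowGraph

open Set Filter Topology Metric MeasureTheory intervalIntegral
open scoped InnerProductSpace NNReal

/-! ## §18 G8 — tracking by the homogenised generator `Ḡ₁ = −(1/P)∫₀ᴾ (A₁₁ + A₁₂N)` -/

section Homogenised

set_option maxHeartbeats 400000 in
/-- **G8 — SLOW-AMPLITUDE TRACKING BY THE LINEAR-RESPONSE (HOMOGENISED) GENERATOR.**  As G6′, but the averaged generator is built from the periodic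
LINEAR response `N` (`Ṅ = A₂₁ + A₂₂N`, `N (t+P) = N t`, `‖N 0‖ ≤ 2δ/γ`; part 8) instead of the Riccati graph:
`Ḡ₁ := −(1/P)∫₀ᴾ (A₁₁ s + A₁₂ s ∘ N s) ds` — the Green–Kubo / cell-corrector form, LINEAR in the couplings.  Hypotheses: block system with coefficients
continuous and `P`-periodic on `[0, T]` (all four blocks), G1's constants, coercivity `r_lo‖v‖² ≤ ⟪Ḡ₁v,v⟫`, a priori bound `‖x s‖ ≤ Mx`, empty-graph datum
`z 0 = 0`, and any `η ≥ δ(r/κ + (r + 2δ/γ)(2/γ))/P + δ·r(s₀ + δr)/γ` (transients of the graph and of the linear response, plus the PERSISTENT relatively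
quadratic drift `δ·r(s₀+δr)/γ` of G3/G7 — the source of `σ = 2`).  Conclusion: `‖x t − e^{−tḠ₁}x 0‖ ≤ Mx·(η(min(t,1/r_lo) + P) + L_g P(1 + (2G_n + L_g)/r_lo))`,
`L_g = 2(s₀ + δr)`, `G_n = s₀ + δr`.  Proof: G5′ gives the Riccati graph `M` internally; G0 + G2, G1, G4, G7 (`‖M − N‖`), periodic window means, ad-lit's
Besjes/SVM lemma `PeriodicAveraging.norm_sub_exp_apply_le`. [cite: SandersVerhulstMurdock2007, Thm 2.8.1 / Thm 5.5.1 (linear case)] -/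
theorem slow_tracking_linear_response (E F : Type) [NormedAddCommGroup E] [InnerProductSpace ℝ E] [FiniteDimensional ℝ E]
    [NormedAddCommGroup F] [InnerProductSpace ℝ F] [FiniteDimensional ℝ F]
    (A₁₁ : ℝ → E →L[ℝ] E) (A₁₂ : ℝ → F →L[ℝ] E) (A₂₁ : ℝ → E →L[ℝ] F) (A₂₂ : ℝ → F →L[ℝ] F)
    (N : ℝ → E →L[ℝ] F) (x : ℝ → E) (z : ℝ → F) (γ δ s₀ rlo η P T : ℝ)
    (hδ : 0 ≤ δ) (hs₀ : 0 ≤ s₀) (hsγ : s₀ < γ) (h8 : 8 * δ ^ 2 ≤ (γ - s₀) ^ 2) (hP : 0 < P) (hPT : P ≤ T)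
    (hA₂₂ : ∀ t ∈ Icc 0 T, ∀ z : F, ⟪A₂₂ t z, z⟫_ℝ ≤ -γ * ‖z‖ ^ 2)
    (h₁₁ : ∀ t ∈ Icc 0 T, ‖A₁₁ t‖ ≤ s₀) (h₁₂ : ∀ t ∈ Icc 0 T, ‖A₁₂ t‖ ≤ δ) (h₂₁ : ∀ t ∈ Icc 0 T, ‖A₂₁ t‖ ≤ δ)
    (hc₁₁ : ContinuousOn A₁₁ (Icc 0 T)) (hc₁₂ : ContinuousOn A₁₂ (Icc 0 T)) (hc₂₁ : ContinuousOn A₂₁ (Icc 0 T))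
    (hc₂₂ : ContinuousOn A₂₂ (Icc 0 T))
    (hp₁₁ : ∀ t, 0 ≤ t → t + P ≤ T → A₁₁ (t + P) = A₁₁ t) (hp₁₂ : ∀ t, 0 ≤ t → t + P ≤ T → A₁₂ (t + P) = A₁₂ t)
    (hp₂₁ : ∀ t, 0 ≤ t → t + P ≤ T → A₂₁ (t + P) = A₂₁ t) (hp₂₂ : ∀ t, 0 ≤ t → t + P ≤ T → A₂₂ (t + P) = A₂₂ t)
    (hrlo : 0 < rlo)
    (hcoer : ∀ v : E, rlo * ‖v‖ ^ 2 ≤ ⟪(-(1 / P) • ∫ s in (0:ℝ)..P, (A₁₁ s + (A₁₂ s).comp (N s))) v, v⟫_ℝ)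
    (hNc : ContinuousOn N (Icc 0 T)) (hNd : ∀ t ∈ Ico 0 T, HasDerivAt N (A₂₁ t + (A₂₂ t).comp (N t)) t)
    (hN0 : ‖N 0‖ ≤ 2 * δ / γ) (hNp : ∀ t, 0 ≤ t → t + P ≤ T → N (t + P) = N t)
    (hη : δ * ((2 * δ / (γ - s₀)) / ((γ - s₀) * (1 - (2 * δ / (γ - s₀)) ^ 2)) + (2 * δ / (γ - s₀) + 2 * δ / γ) * (2 / γ)) / P +
      δ * ((2 * δ / (γ - s₀)) * (s₀ + δ * (2 * δ / (γ - s₀))) / γ) ≤ η)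
    (hx : ∀ t ∈ Ico 0 T, HasDerivAt x (A₁₁ t (x t) + A₁₂ t (z t)) t)
    (hz : ∀ t ∈ Ico 0 T, HasDerivAt z (A₂₁ t (x t) + A₂₂ t (z t)) t)
    (hxc : ContinuousOn x (Icc 0 T)) (hzc : ContinuousOn z (Icc 0 T)) (hz0 : z 0 = 0)
    (Mx : ℝ) (hxM : ∀ s ∈ Icc 0 T, ‖x s‖ ≤ Mx) :
    ∀ t ∈ Ico 0 T, ‖x t - NormedSpace.exp (-(t • (-(1 / P) • ∫ s in (0:ℝ)..P, (A₁₁ s + (A₁₂ s).comp (N s))))) (x 0)‖ ≤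
      Mx * (η * (min t (1 / rlo) + P) +
        (2 * (s₀ + δ * (2 * δ / (γ - s₀)))) * P *
          (1 + (2 * (s₀ + δ * (2 * δ / (γ - s₀))) + 2 * (s₀ + δ * (2 * δ / (γ - s₀)))) / rlo)) := by
  intro t ht
  have hγ : 0 < γ := lt_of_le_of_lt hs₀ hsγ
  have hgs : 0 < γ - s₀ := by linarith
  have hT : 0 ≤ T := hP.le.trans hPT
  set r := 2 * δ / (γ - s₀) with hr
  have hr0 : 0 ≤ r := by positivity
  have hr2 : r ^ 2 ≤ 1 / 2 := by
    rw [hr, div_pow, div_le_div_iff₀ (by positivity) (by norm_num)]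
    nlinarith
  set κ := (γ - s₀) * (1 - r ^ 2) with hκ
  have hκpos : 0 < κ := mul_pos hgs (by linarith)
  -- G0: the graph from the empty graph; G1: the ball for `L` and `M`
  obtain ⟨L, hL0, hLc, hLd, hLb⟩ := riccatiGraph_exists E F A₁₁ A₁₂ A₂₁ A₂₂ γ δ s₀ T hδ hs₀ hsγ h8 hT hA₂₂ h₁₁ h₁₂ h₂₁ hc₁₁ hc₁₂ hc₂₁ hc₂₂
  obtain ⟨M, hMc, hMd, hMb, hMp⟩ := riccatiGraph_periodic_on E F A₁₁ A₁₂ A₂₁ A₂₂ γ δ s₀ P T hδ hs₀ hsγ h8 hP hPT hA₂₂ h₁₁ h₁₂ h₂₁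
    hc₁₁ hc₁₂ hc₂₁ hc₂₂ hp₁₁ hp₁₂ hp₂₁ hp₂₂
  have hM0 : ‖M 0‖ ≤ r := hMb 0 ⟨le_rfl, hT⟩
  have hNb : ∀ s ∈ Icc 0 T, ‖N s‖ ≤ r := by
    -- the linear response stays in the ball `2δ/γ ≤ r` (G1 at `A₁₁ = A₁₂ = 0`)
    have h8l : 8 * δ ^ 2 ≤ (γ - 0) ^ 2 := by rw [sub_zero]; nlinarith
    have hNd' : ∀ s ∈ Ico 0 T, HasDerivAt N (A₂₁ s + (A₂₂ s).comp (N s) - (N s).comp ((fun _ : ℝ => (0 : E →L[ℝ] E)) s) -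
        ((N s).comp ((fun _ : ℝ => (0 : F →L[ℝ] E)) s)).comp (N s)) s := fun s hs => by
      have h := hNd s hs; rwa [← riccati_zero_zero (A₂₁ s) (A₂₂ s) (N s)] at h
    have hb := riccatiInvariantBall E F (fun _ => (0 : E →L[ℝ] E)) (fun _ => (0 : F →L[ℝ] E)) A₂₁ A₂₂ N γ δ 0 T hγ hδ le_rfl hγ h8l hT
      hA₂₂ (fun _ _ => by rw [norm_zero]) (fun _ _ => by rw [norm_zero]; exact hδ) h₂₁ hNd' hNc (by rw [sub_zero]; exact hN0)
    intro s hs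
    have h1 : 2 * δ / (γ - 0) ≤ r := by rw [sub_zero, hr]; exact div_le_div_of_nonneg_left (by linarith) hgs (by linarith)
    exact (hb s hs).trans h1
  -- G7: the Riccati graph vs the linear response
  have hMN : ∀ s ∈ Icc 0 T, ‖M s - N s‖ ≤ r * (s₀ + δ * r) / γ + (r + 2 * δ / γ) * Real.exp (-(γ / 2) * s) := fun s hs =>
    norm_riccati_sub_linear_le E F A₁₁ A₁₂ A₂₁ A₂₂ M N γ δ s₀ T hδ hs₀ hsγ h8 hT hA₂₂ h₁₁ h₁₂ h₂₁ hc₂₁ hc₂₂ hMc hMd hM0 hNc hNd hN0 s hs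
  -- G2: exact reduction (needs a uniform bound `B`)
  obtain ⟨C₂₂, hC₂₂⟩ := isCompact_Icc.exists_bound_of_continuousOn hc₂₂
  set B := max C₂₂ (max δ r) with hB
  have hBall : ∀ s ∈ Icc 0 T, ‖A₂₂ s‖ ≤ B ∧ ‖A₁₂ s‖ ≤ B ∧ ‖L s‖ ≤ B := fun s hs =>
    ⟨(hC₂₂ s hs).trans (le_max_left _ _), (h₁₂ s hs).trans ((le_max_left _ _).trans (le_max_right _ _)),
      (hLb s hs).trans ((le_max_right _ _).trans (le_max_right _ _))⟩
  have hLx0 : z 0 = L 0 (x 0) := by rw [hz0, hL0]; rfl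
  obtain ⟨_, hxd⟩ := graphReduction E F A₁₁ A₁₂ A₂₁ A₂₂ L x z T B hT hBall hLd hx hz hLc hxc hzc hLx0
  -- G4: the transient `‖L s − M s‖ ≤ r e^{−κ s}`
  have hLM : ∀ s ∈ Icc 0 T, ‖L s - M s‖ ≤ r * Real.exp (-(κ * s)) := by
    intro s hs
    have h := riccati_contraction E F A₁₁ A₁₂ A₂₁ A₂₂ L M γ δ s₀ T hγ hδ hs₀ hsγ h8 hT hA₂₂ h₁₁ h₁₂ h₂₁ hLd hMd hLc hMc
      (by rw [hL0, norm_zero]; exact hr0) hM0 s hs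
    rw [hL0, zero_sub, norm_neg] at h
    calc ‖L s - M s‖ ≤ Real.exp (-((γ - s₀) * (1 - (2 * δ / (γ - s₀)) ^ 2)) * s) * ‖M 0‖ := h
      _ ≤ Real.exp (-((γ - s₀) * (1 - (2 * δ / (γ - s₀)) ^ 2)) * s) * r := mul_le_mul_of_nonneg_left hM0 (Real.exp_pos _).le
      _ = r * Real.exp (-(κ * s)) := by rw [hκ, hr, mul_comm, neg_mul]
  -- the periodic integrand `F s = A₁₁ s + A₁₂ s ∘ M s`, the averaged generator `Ḡ`
  set Fm : ℝ → E →L[ℝ] E := fun s => A₁₁ s + (A₁₂ s).comp (N s) with hFm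
  have hFmc : ContinuousOn Fm (Icc 0 T) := hc₁₁.add (hc₁₂.clm_comp hNc)
  have hFmi : ∀ a b, 0 ≤ a → a ≤ b → b ≤ T → IntervalIntegrable Fm volume a b := fun a b ha hab hb =>
    (hFmc.mono (Icc_subset_Icc ha hb)).intervalIntegrable_of_Icc hab
  have hFmn : ∀ s ∈ Icc 0 T, ‖Fm s‖ ≤ s₀ + δ * r := fun s hs =>
    (norm_add_le _ _).trans (add_le_add (h₁₁ s hs) ((ContinuousLinearMap.opNorm_comp_le _ _).trans
      (mul_le_mul (h₁₂ s hs) (hNb s hs) (norm_nonneg _) hδ)))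
  have hFmp : ∀ s, 0 ≤ s → s + P ≤ T → Fm (s + P) = Fm s := fun s hs hsP => by
    simp only [hFm, hp₁₁ s hs hsP, hp₁₂ s hs hsP, hNp s hs hsP]
  set Gbar : E →L[ℝ] E := -(1 / P) • ∫ s in (0:ℝ)..P, Fm s with hGbar
  have hintF : ∫ s in (0:ℝ)..P, Fm s = -(P • Gbar) := by
    rw [hGbar, smul_smul]; field_simp; simp
  have hGn0 : 0 ≤ s₀ + δ * r := by positivity
  have hGn : ‖Gbar‖ ≤ s₀ + δ * r := by
    rw [hGbar, norm_smul, norm_neg, Real.norm_eq_abs, abs_of_pos (by positivity : (0:ℝ) < 1 / P)]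
    have h := intervalIntegral.norm_integral_le_of_norm_le_const (a := (0:ℝ)) (b := P) (C := s₀ + δ * r) (f := Fm)
      (fun s hs => hFmn s ⟨(uIoc_of_le hP.le ▸ hs).1.le, ((uIoc_of_le hP.le ▸ hs).2).trans hPT⟩)
    rw [sub_zero, abs_of_pos hP] at h
    calc 1 / P * ‖∫ s in (0:ℝ)..P, Fm s‖ ≤ 1 / P * ((s₀ + δ * r) * P) := mul_le_mul_of_nonneg_left h (by positivity)
      _ = s₀ + δ * r := by field_simp
  have hcoer' : ∀ v : E, rlo * ‖v‖ ^ 2 ≤ ⟪Gbar v, v⟫_ℝ := fun v => by rw [hGbar]; exact hcoer v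
  -- time clamp and the perturbation `g`
  set c : ℝ → ℝ := fun s => max 0 (min s T) with hc
  have hc_mem : ∀ s, c s ∈ Icc 0 T := fun s => ⟨le_max_left _ _, max_le hT (min_le_right _ _)⟩
  have hc_id : ∀ s ∈ Icc 0 T, c s = s := fun s hs => by
    show max 0 (min s T) = s
    rw [min_eq_left hs.2, max_eq_right hs.1]
  have hc_cont : Continuous c := continuous_const.max (continuous_id.min continuous_const)
  set g : ℝ → E →L[ℝ] E := fun s => -(A₁₁ (c s) + (A₁₂ (c s)).comp (L (c s))) - Gbar with hg
  have hgc : Continuous g := by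
    have h1 : Continuous fun s => A₁₁ (c s) := hc₁₁.comp_continuous hc_cont hc_mem
    have h2 : Continuous fun s => A₁₂ (c s) := hc₁₂.comp_continuous hc_cont hc_mem
    have h3 : Continuous fun s => L (c s) := hLc.comp_continuous hc_cont hc_mem
    exact (h1.add (h2.clm_comp h3)).neg.sub continuous_const
  have hLg : ∀ s ∈ Icc 0 t, ‖g s‖ ≤ 2 * (s₀ + δ * r) := by
    intro s _
    have hcs := hc_mem s
    have h1 : ‖A₁₁ (c s) + (A₁₂ (c s)).comp (L (c s))‖ ≤ s₀ + δ * r :=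
      (norm_add_le _ _).trans (add_le_add (h₁₁ _ hcs) ((ContinuousLinearMap.opNorm_comp_le _ _).trans
        (mul_le_mul (h₁₂ _ hcs) (hLb _ hcs) (norm_nonneg _) hδ)))
    calc ‖g s‖ ≤ ‖-(A₁₁ (c s) + (A₁₂ (c s)).comp (L (c s)))‖ + ‖Gbar‖ := norm_sub_le _ _
      _ ≤ (s₀ + δ * r) + (s₀ + δ * r) := by rw [norm_neg]; exact add_le_add h1 hGn
      _ = 2 * (s₀ + δ * r) := by ring
  -- the reduced equation in averaging form
  have hxd' : ∀ s ∈ Icc 0 t, HasDerivAt x (-(Gbar (x s) + g s (x s))) s := by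
    intro s hs
    have hsI : s ∈ Ico 0 T := ⟨hs.1, lt_of_le_of_lt hs.2 ht.2⟩
    refine (hxd s hsI).congr_deriv ?_
    simp only [hg, hc_id s (Ico_subset_Icc_self hsI), FunLike.coe_sub, FunLike.coe_add, FunLike.coe_neg, Pi.sub_apply, Pi.add_apply,
      Pi.neg_apply, ContinuousLinearMap.comp_apply]
    abel
  have hxM' : ∀ s ∈ Icc 0 t, ‖x s‖ ≤ Mx := fun s hs => hxM s ⟨hs.1, hs.2.trans ht.2.le⟩
  -- window means: the periodic part averages to `−PḠ` exactly, the transient `A₁₂(L − M)` to at most `δr/κ`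
  set R := r + 2 * δ / γ with hR
  set Fd := r * (s₀ + δ * r) / γ with hFd
  have hR0 : 0 ≤ R := by positivity
  have hFd0 : 0 ≤ Fd := by positivity
  have hmean : ∀ n : ℕ, ((n:ℝ) + 1) * P ≤ t →
      ‖∫ s in ((n:ℝ) * P)..(((n:ℝ) + 1) * P), g s‖ ≤ η * P := by
    intro n hn
    have hn0 : 0 ≤ (n:ℝ) * P := by positivity
    have hnle : (n:ℝ) * P ≤ ((n:ℝ) + 1) * P := by nlinarith
    have hn1T : ((n:ℝ) + 1) * P ≤ T := hn.trans ht.2.le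
    have hwin : ∀ s ∈ uIcc ((n:ℝ) * P) (((n:ℝ) + 1) * P), s ∈ Icc 0 T := fun s hs => by
      rw [uIcc_of_le hnle] at hs; exact ⟨hn0.trans hs.1, hs.2.trans hn1T⟩
    -- split `g = (−Fm − Ḡ) − A₁₂ ∘ (L − M)` on the window
    have hsplit : EqOn g (fun s => (-(Fm s) - Gbar) - (A₁₂ s).comp (L s - N s)) (uIcc ((n:ℝ) * P) (((n:ℝ) + 1) * P)) := by
      intro s hs
      have hsT := hwin s hs
      simp only [hg, hFm, hc_id s hsT, ContinuousLinearMap.comp_sub]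
      abel
    rw [intervalIntegral.integral_congr hsplit]
    have hiF : IntervalIntegrable Fm volume ((n:ℝ) * P) (((n:ℝ) + 1) * P) := hFmi _ _ hn0 hnle hn1T
    have hiFn : IntervalIntegrable (fun s => -(Fm s)) volume ((n:ℝ) * P) (((n:ℝ) + 1) * P) := hiF.neg
    have hi1 : IntervalIntegrable (fun s => -(Fm s) - Gbar) volume ((n:ℝ) * P) (((n:ℝ) + 1) * P) :=
      hiFn.sub intervalIntegrable_const
    have hcD : ContinuousOn (fun s => (A₁₂ s).comp (L s - N s)) (Icc 0 T) := hc₁₂.clm_comp (hLc.sub hNc)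
    have hi2 : IntervalIntegrable (fun s => (A₁₂ s).comp (L s - N s)) volume ((n:ℝ) * P) (((n:ℝ) + 1) * P) :=
      (hcD.mono (Icc_subset_Icc hn0 hn1T)).intervalIntegrable_of_Icc hnle
    rw [intervalIntegral.integral_sub hi1 hi2, intervalIntegral.integral_sub hiFn intervalIntegrable_const,
      intervalIntegral.integral_neg, intervalIntegral.integral_const]
    -- periodicity: `∫_{nP}^{(n+1)P} Fm = ∫₀^P Fm = −P Ḡ`
    have hper : ∫ s in ((n:ℝ) * P)..(((n:ℝ) + 1) * P), Fm s = ∫ s in (0:ℝ)..P, Fm s := by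
      have h := intervalIntegral.integral_comp_add_right (fun s => Fm s) ((n:ℝ) * P) (a := 0) (b := P)
      rw [zero_add, show P + (n:ℝ) * P = ((n:ℝ) + 1) * P by ring] at h
      rw [← h]
      refine intervalIntegral.integral_congr fun s hs => ?_
      rw [uIcc_of_le hP.le] at hs
      exact periodic_shift_nat hP.le hFmp n s hs.1 (by nlinarith [hs.2])
    rw [hper, hintF]
    have e0 : -(-(P • Gbar)) - (((n:ℝ) + 1) * P - (n:ℝ) * P) • Gbar = 0 := by
      rw [show ((n:ℝ) + 1) * P - (n:ℝ) * P = P by ring]; simp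
    rw [e0, zero_sub, norm_neg]
    -- the defect `A₁₂ ∘ (L − N)`: transient of the graph + (Riccati − linear)
    have hbd : ∀ᵐ s ∂volume, s ∈ Ioc ((n:ℝ) * P) (((n:ℝ) + 1) * P) →
        ‖(A₁₂ s).comp (L s - N s)‖ ≤ δ * (r * Real.exp (-(κ * s)) + Fd + R * Real.exp (-(γ / 2 * s))) := by
      refine Filter.Eventually.of_forall fun s hs => ?_
      have hsT : s ∈ Icc 0 T := ⟨hn0.trans hs.1.le, hs.2.trans hn1T⟩
      have hLN : ‖L s - N s‖ ≤ r * Real.exp (-(κ * s)) + Fd + R * Real.exp (-(γ / 2 * s)) := by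
        have e : L s - N s = (L s - M s) + (M s - N s) := by abel
        rw [e]
        have h1 := hLM s hsT
        have h2 := hMN s hsT
        have h3 : Real.exp (-(γ / 2) * s) = Real.exp (-(γ / 2 * s)) := by ring_nf
        rw [h3] at h2
        calc ‖(L s - M s) + (M s - N s)‖ ≤ ‖L s - M s‖ + ‖M s - N s‖ := norm_add_le _ _
          _ ≤ r * Real.exp (-(κ * s)) + (r * (s₀ + δ * r) / γ + (r + 2 * δ / γ) * Real.exp (-(γ / 2 * s))) := add_le_add h1 h2
          _ = r * Real.exp (-(κ * s)) + Fd + R * Real.exp (-(γ / 2 * s)) := by rw [hFd, hR]; ring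
      calc ‖(A₁₂ s).comp (L s - N s)‖ ≤ ‖A₁₂ s‖ * ‖L s - N s‖ := ContinuousLinearMap.opNorm_comp_le _ _
        _ ≤ δ * (r * Real.exp (-(κ * s)) + Fd + R * Real.exp (-(γ / 2 * s))) := mul_le_mul (h₁₂ s hsT) hLN (norm_nonneg _) hδ
    have hce1 : Continuous fun s : ℝ => Real.exp (-(κ * s)) := Real.continuous_exp.comp (continuous_const.mul continuous_id).neg
    have hce2 : Continuous fun s : ℝ => Real.exp (-(γ / 2 * s)) := Real.continuous_exp.comp (continuous_const.mul continuous_id).neg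
    have hie : IntervalIntegrable (fun s => δ * (r * Real.exp (-(κ * s)) + Fd + R * Real.exp (-(γ / 2 * s)))) volume
        ((n:ℝ) * P) (((n:ℝ) + 1) * P) :=
      (continuous_const.mul (((continuous_const.mul hce1).add continuous_const).add (continuous_const.mul hce2))).intervalIntegrable _ _
    have hI1 := integral_exp_neg_mul_le (b := ((n:ℝ) + 1) * P) hκpos hn0
    have hI2 := integral_exp_neg_mul_le (b := ((n:ℝ) + 1) * P) (κ := γ / 2) (by positivity) hn0
    have hsum : ∫ s in ((n:ℝ) * P)..(((n:ℝ) + 1) * P), δ * (r * Real.exp (-(κ * s)) + Fd + R * Real.exp (-(γ / 2 * s))) =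
        δ * (r * (∫ s in ((n:ℝ) * P)..(((n:ℝ) + 1) * P), Real.exp (-(κ * s))) + (((n:ℝ) + 1) * P - (n:ℝ) * P) * Fd +
          R * ∫ s in ((n:ℝ) * P)..(((n:ℝ) + 1) * P), Real.exp (-(γ / 2 * s))) := by
      rw [intervalIntegral.integral_const_mul, intervalIntegral.integral_add, intervalIntegral.integral_add,
        intervalIntegral.integral_const_mul, intervalIntegral.integral_const_mul, intervalIntegral.integral_const, smul_eq_mul]
      · exact ((continuous_const.mul hce1).intervalIntegrable _ _)
      · exact intervalIntegrable_const
      · exact (((continuous_const.mul hce1).add continuous_const).intervalIntegrable _ _)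
      · exact ((continuous_const.mul hce2).intervalIntegrable _ _)
    calc ‖∫ s in ((n:ℝ) * P)..(((n:ℝ) + 1) * P), (A₁₂ s).comp (L s - N s)‖
        ≤ ∫ s in ((n:ℝ) * P)..(((n:ℝ) + 1) * P), δ * (r * Real.exp (-(κ * s)) + Fd + R * Real.exp (-(γ / 2 * s))) :=
          intervalIntegral.norm_integral_le_of_norm_le hnle hbd hie
      _ = δ * (r * (∫ s in ((n:ℝ) * P)..(((n:ℝ) + 1) * P), Real.exp (-(κ * s))) + (((n:ℝ) + 1) * P - (n:ℝ) * P) * Fd +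
          R * ∫ s in ((n:ℝ) * P)..(((n:ℝ) + 1) * P), Real.exp (-(γ / 2 * s))) := hsum
      _ ≤ δ * (r * (1 / κ) + P * Fd + R * (1 / (γ / 2))) := by
          rw [show ((n:ℝ) + 1) * P - (n:ℝ) * P = P by ring]
          gcongr
      _ = (δ * (r / κ + R * (2 / γ)) / P + δ * Fd) * P := by field_simp; ring
      _ ≤ η * P := mul_le_mul_of_nonneg_right hη hP.le
  -- Besjes / Sanders–Verhulst–Murdock averaging (ad-lit `LinearPeriodicAveraging`)
  haveI : CompleteSpace E := FiniteDimensional.complete ℝ E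
  have hη1 : (0:ℝ) ≤ δ * (r / κ + R * (2 / γ)) / P + δ * Fd :=
    add_nonneg (div_nonneg (mul_nonneg hδ (add_nonneg (div_nonneg hr0 hκpos.le) (mul_nonneg hR0 (div_nonneg zero_le_two hγ.le)))) hP.le)
      (mul_nonneg hδ hFd0)
  have hη0 : 0 ≤ η := hη1.trans hη
  have key := Literature.Analysis.ODE.PeriodicAveraging.norm_sub_exp_apply_le Gbar hgc x hrlo hP hη0 ht.1 hcoer' hGn hLg hmean hxd' hxM'
  simpa only [hr] using key



end Homogenised

/-! ## §19 The a priori bound from block dissipativity (energy) -/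

section Energy

/-- **A PRIORI BOUND FROM ENERGY**: if the full block generator is dissipative, `⟪x, A₁₁x + A₁₂z⟫ + ⟪z, A₂₁x + A₂₂z⟫ ≤ 0` (for the Galerkin cell system:
antisymmetric Leray-projected transport couplings + dissipative diagonal blocks), then `‖x t‖² + ‖z t‖² ≤ ‖x 0‖² + ‖z 0‖²` along the block flow; with the
empty-graph datum `z 0 = 0` this is the hypothesis `‖x s‖ ≤ ‖x 0‖` (`Mx = ‖x 0‖`) of `slow_tracking_of_coercive` / `slow_tracking_linear_response`. [folklore] -/
theorem norm_slow_le_of_dissipative {E F : Type*} [NormedAddCommGroup E] [InnerProductSpace ℝ E] [NormedAddCommGroup F] [InnerProductSpace ℝ F]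
    (A₁₁ : ℝ → E →L[ℝ] E) (A₁₂ : ℝ → F →L[ℝ] E) (A₂₁ : ℝ → E →L[ℝ] F) (A₂₂ : ℝ → F →L[ℝ] F) (x : ℝ → E) (z : ℝ → F) {T : ℝ}
    (hdiss : ∀ t ∈ Icc 0 T, ∀ (u : E) (v : F), ⟪u, A₁₁ t u + A₁₂ t v⟫_ℝ + ⟪v, A₂₁ t u + A₂₂ t v⟫_ℝ ≤ 0)
    (hx : ∀ t ∈ Ico 0 T, HasDerivAt x (A₁₁ t (x t) + A₁₂ t (z t)) t) (hz : ∀ t ∈ Ico 0 T, HasDerivAt z (A₂₁ t (x t) + A₂₂ t (z t)) t)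
    (hxc : ContinuousOn x (Icc 0 T)) (hzc : ContinuousOn z (Icc 0 T)) (hz0 : z 0 = 0) :
    ∀ t ∈ Icc 0 T, ‖x t‖ ≤ ‖x 0‖ := by
  intro t ht
  have hcont : ContinuousOn (fun s => ‖x s‖ ^ 2 + ‖z s‖ ^ 2) (Icc 0 T) := ((hxc.norm).pow 2).add ((hzc.norm).pow 2)
  have hder : ∀ s ∈ Ico 0 T, HasDerivWithinAt (fun s => ‖x s‖ ^ 2 + ‖z s‖ ^ 2)
      (2 * ⟪x s, A₁₁ s (x s) + A₁₂ s (z s)⟫_ℝ + 2 * ⟪z s, A₂₁ s (x s) + A₂₂ s (z s)⟫_ℝ) (Ici s) s :=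
    fun s hs => ((hx s hs).norm_sq.add (hz s hs).norm_sq).hasDerivWithinAt
  have key := image_le_of_deriv_right_le_deriv_boundary hcont hder (B := fun _ => ‖x 0‖ ^ 2 + ‖z 0‖ ^ 2) (B' := fun _ => (0:ℝ)) le_rfl
    continuousOn_const (fun s _ => (hasDerivAt_const s _).hasDerivWithinAt) (fun s hs => by
      have h := hdiss s (Ico_subset_Icc_self hs) (x s) (z s)
      show 2 * ⟪x s, A₁₁ s (x s) + A₁₂ s (z s)⟫_ℝ + 2 * ⟪z s, A₂₁ s (x s) + A₂₂ s (z s)⟫_ℝ ≤ 0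
      linarith)
  have h1 : ‖x t‖ ^ 2 + ‖z t‖ ^ 2 ≤ ‖x 0‖ ^ 2 + ‖z 0‖ ^ 2 := key ht
  rw [hz0, norm_zero, zero_pow two_ne_zero, add_zero] at h1
  have h2 : ‖x t‖ ^ 2 ≤ ‖x 0‖ ^ 2 := le_trans (le_add_of_nonneg_right (sq_nonneg _)) h1
  exact (pow_le_pow_iff_left₀ (norm_nonneg _) (norm_nonneg _) two_ne_zero).mp h2

end Energy

end SlowGraph

end Summit.AnomalousDissipation.AnomalousDissipation.Theorems.SolenoidalFractalHomogenisation.LagrangianStep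

end
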